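import Summits.CriticalPhenomena.PercolationContinuityZ3.Theorems.PercNearOneGluingAdditiveGluingDKernelInterp
import Summits.CriticalPhenomena.PercolationContinuityZ3.Theorems.PercNearOneGluingAdditiveGluingEdgeSwitch
import HarnessLib

/-! # Crux `PercNearOneGluing.AdditiveGluing` (stmt-CriticalPhenomena-4576) — one-edge layers of the designated-pocket kernel:
# every minimiser of the two-point function with ONE block edge deleted is `D`-good (seat (d) round 4)

Support file (`--supports stmt-CriticalPhenomena-4576`); no definitions, no named facts.

`μ_u = prodBernoulli u`, relays `A ∋ b`, block `S`, `u/S` the glued weighting, `D(u,S,d) : μ_{u/S}((S↔A) ∩ (d↔b)) ≤ μ_{u/S}(S↔b)`.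
For a block edge `e = s(x,y)` (`x ∈ S ∌ y`) with `u₀ = u[e↦0]`, `u₁ = u[e↦1]`:
* `dKernel_sure_insert`: `D(u₀, insert y S, d) → D(u₁, S, d)` — in `u₁/S` the pair `e` is sure, so the `S`-events sit inside the
  `insert y S`-events (`S ↔ X ⊆ insert y S ↔ X`, with equality of reaches by `edgeSw_biUnion_insert_iff`), and gluing `insert y S` on top of
  `u₁/S` is the glue pushforward (`stub_gluePushforward`, `blockGrowth_glue_preimage_*`), whose preimage can only enlarge `{d ↔ b}`;
* `dKernel_of_edgeLayers`: `D(u₀,S,d) ∧ D(u₀, insert y S, d) → D(u,S,d)` (with the exact interpolation `dKernel_interp`);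
* `dKernel_of_edgeMin` / `dKernel_of_edgeSwitch`: a minimiser `d` of `μ_{u₀}(·↔b)` over `A` is `D`-good for `(u,S)` once every block
  disjoint from `A` is `d`-good in `u₀` (inner induction hypothesis; the layer `insert y S` is Lemma 5 when `y ∈ A`), and `a₀` is `D`-good
  as soon as `κ_{u/S}(a₀) ≤ κ_{u/S}(d)` — the D-version of `blockGood_of_edgeSwitch`.
[cite: KozmaNitzan2024, §3.2 Lemma 5 p. 13, Thms 4–5 pp. 12–14, §5.3 p. 34, §3.1 Remark p. 5 (gluing)]
-/

namespace Summit.CriticalPhenomena.PercolationContinuityZ3.Theorems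

open MeasureTheory Set
open Literature.Probability.LatticeModels (prodBernoulli)
open Literature.Probability.Percolation (BondConfig openConn openConnIn openGraph openCluster)
open scoped BigOperators

noncomputable section
open Classical

section DKernelEdge

open Literature.Probability.LatticeModels Literature.Probability.Percolation

variable {n : ℕ}

/-- Gluing `insert y S` on top of `u[s(x,y) ↦ 1]/S` is gluing `insert y S` on `u[s(x,y) ↦ 0]`. [folklore] -/
theorem dEdge_glue_glue (u : Sym2 (Fin n) → unitInterval) (S : Finset (Fin n)) (x y : Fin n) (hxS : x ∈ S) (hxy : x ≠ y) :
    (fun e' : Sym2 (Fin n) => if (∀ z ∈ e', z ∈ insert y S) ∧ ¬ e'.IsDiag then 1 else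
        (fun e'' : Sym2 (Fin n) => if (∀ z ∈ e'', z ∈ S) ∧ ¬ e''.IsDiag then 1 else Function.update u s(x, y) 1 e'') e')
      = (fun e' : Sym2 (Fin n) => if (∀ z ∈ e', z ∈ insert y S) ∧ ¬ e'.IsDiag then 1 else Function.update u s(x, y) 0 e') := by
  funext e'
  by_cases hT : (∀ z ∈ e', z ∈ insert y S) ∧ ¬ e'.IsDiag
  · rw [if_pos hT, if_pos hT]
  · rw [if_neg hT, if_neg hT]
    have hS : ¬ ((∀ z ∈ e', z ∈ S) ∧ ¬ e'.IsDiag) := fun h => hT ⟨fun z hz => Finset.mem_insert_of_mem (h.1 z hz), h.2⟩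
    show (if (∀ z ∈ e', z ∈ S) ∧ ¬ e'.IsDiag then 1 else Function.update u s(x, y) 1 e') = Function.update u s(x, y) 0 e'
    rw [if_neg hS]
    have hne : e' ≠ s(x, y) := by
      intro h
      subst h
      exact hT ⟨fun z hz => by
        rcases Sym2.mem_iff.1 hz with rfl | rfl
        · exact Finset.mem_insert_of_mem hxS
        · exact Finset.mem_insert_self _ _, by rw [Sym2.mk_isDiag_iff]; exact hxy⟩
    rw [Function.update_of_ne hne, Function.update_of_ne hne]

/-- **A surely attached vertex may be dropped from the block (D-kernel).**  For `e = s(x,y)`, `x ∈ S ∌ y`: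
`D(u[e↦0], insert y S, d) → D(u[e↦1], S, d)`.  [cite: KozmaNitzan2024, §3.1 Remark p. 5 (gluing)] -/
theorem dKernel_sure_insert (u : Sym2 (Fin n) → unitInterval) (A S : Finset (Fin n)) (b d x y : Fin n)
    (hxS : x ∈ S) (hyS : y ∉ S)
    (hT : (prodBernoulli (fun e' : Sym2 (Fin n) => if (∀ z ∈ e', z ∈ insert y S) ∧ ¬ e'.IsDiag then 1 else Function.update u s(x, y) 0 e')).real
          ((⋃ v ∈ insert y S, ⋃ a ∈ A, openConn v a) ∩ openConn d b)
        ≤ (prodBernoulli (fun e' : Sym2 (Fin n) => if (∀ z ∈ e', z ∈ insert y S) ∧ ¬ e'.IsDiag then 1 else Function.update u s(x, y) 0 e')).real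
          (⋃ v ∈ insert y S, openConn v b)) :
    (prodBernoulli (fun e' : Sym2 (Fin n) => if (∀ z ∈ e', z ∈ S) ∧ ¬ e'.IsDiag then 1 else Function.update u s(x, y) 1 e')).real
        ((⋃ v ∈ S, ⋃ a ∈ A, openConn v a) ∩ openConn d b)
      ≤ (prodBernoulli (fun e' : Sym2 (Fin n) => if (∀ z ∈ e', z ∈ S) ∧ ¬ e'.IsDiag then 1 else Function.update u s(x, y) 1 e')).real
        (⋃ v ∈ S, openConn v b) := by
  have hxy : x ≠ y := fun h => hyS (h ▸ hxS)
  set H : Sym2 (Fin n) → unitInterval :=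
    fun e' : Sym2 (Fin n) => if (∀ z ∈ e', z ∈ S) ∧ ¬ e'.IsDiag then 1 else Function.update u s(x, y) 1 e' with hH
  have hHe : H s(x, y) = 1 := by
    rw [hH]
    simp only
    by_cases h : (∀ z ∈ s(x, y), z ∈ S) ∧ ¬ (s(x, y)).IsDiag
    · rw [if_pos h]
    · rw [if_neg h, Function.update_self]
  -- (1) `S`-events inside `insert y S`-events; reaches equal since `e` is sure
  have hE : (prodBernoulli H).real ((⋃ v ∈ S, ⋃ a ∈ A, openConn v a) ∩ openConn d b)
      ≤ (prodBernoulli H).real ((⋃ v ∈ insert y S, ⋃ a ∈ A, openConn v a) ∩ openConn d b) := by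
    refine measureReal_mono (Set.inter_subset_inter_left _ ?_) (measure_ne_top _ _)
    exact Set.biUnion_subset_biUnion_left fun v hv => Finset.mem_insert_of_mem hv
  have hY : (prodBernoulli H).real (⋃ v ∈ insert y S, openConn v b) = (prodBernoulli H).real (⋃ v ∈ S, openConn v b) :=
    edgeSw_real_eq_of_sure H s(x, y) hHe _ _ fun ω he => edgeSw_biUnion_insert_iff S x y b hxS hxy ω he
  -- (2) glue `insert y S` on top of `H`: the push-forward can only enlarge `{d ↔ b}`, and leaves block reaches unchanged
  have hglue := dEdge_glue_glue u S x y hxS hxy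
  have hpre : ((⋃ v ∈ insert y S, ⋃ a ∈ A, openConn v a) ∩ openConn d b : Set (BondConfig (Fin n)))
      ⊆ {ω : BondConfig (Fin n) | (ω ∪ {e | (∀ z ∈ e, z ∈ insert y S) ∧ ¬ e.IsDiag}) ∈
          ((⋃ v ∈ insert y S, ⋃ a ∈ A, openConn v a) ∩ openConn d b : Set (BondConfig (Fin n)))} := by
    intro ω hω
    obtain ⟨hU, hdb⟩ := hω
    obtain ⟨v, hv, hU'⟩ := Set.mem_iUnion₂.1 hU
    obtain ⟨a, ha, hva⟩ := Set.mem_iUnion₂.1 hU'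
    have hmono : ∀ p q : Fin n, (openGraph ω).Adj p q →
        (openGraph (ω ∪ {e | (∀ z ∈ e, z ∈ insert y S) ∧ ¬ e.IsDiag} : BondConfig (Fin n))).Adj p q := fun p q hpq => by
      rw [openGraph_adj] at hpq ⊢
      exact ⟨Or.inl hpq.1, hpq.2⟩
    rw [Set.mem_setOf_eq, Set.mem_inter_iff]
    exact ⟨Set.mem_iUnion₂.2 ⟨v, hv, Set.mem_iUnion₂.2 ⟨a, ha,
        (SimpleGraph.Reachable.mono hmono hva : (openGraph _).Reachable v a)⟩⟩,
      (SimpleGraph.Reachable.mono hmono hdb : (openGraph _).Reachable d b)⟩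
  have hE2 : (prodBernoulli H).real ((⋃ v ∈ insert y S, ⋃ a ∈ A, openConn v a) ∩ openConn d b)
      ≤ (prodBernoulli (fun e' : Sym2 (Fin n) => if (∀ z ∈ e', z ∈ insert y S) ∧ ¬ e'.IsDiag then 1 else Function.update u s(x, y) 0 e')).real
          ((⋃ v ∈ insert y S, ⋃ a ∈ A, openConn v a) ∩ openConn d b) := by
    rw [← hglue, stub_gluePushforward n H (insert y S)]
    exact measureReal_mono hpre (measure_ne_top _ _)
  have hY2 : (prodBernoulli (fun e' : Sym2 (Fin n) => if (∀ z ∈ e', z ∈ insert y S) ∧ ¬ e'.IsDiag then 1 else Function.update u s(x, y) 0 e')).real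
        (⋃ v ∈ insert y S, openConn v b)
      = (prodBernoulli H).real (⋃ v ∈ insert y S, openConn v b) := by
    rw [← hglue]
    exact blockGrowth_glue_real_iUnion H (insert y S) b
  linarith

/-- **D-kernel from the two one-edge layers**: `D(u[e↦0],S,d) ∧ D(u[e↦0], insert y S, d) → D(u,S,d)` (`e = s(x,y)`, `x ∈ S ∌ y`).
[cite: KozmaNitzan2024, §5.3 p. 34, §3.1 Remark p. 5] -/
theorem dKernel_of_edgeLayers (u : Sym2 (Fin n) → unitInterval) (A S : Finset (Fin n)) (b d x y : Fin n)
    (hxS : x ∈ S) (hyS : y ∉ S)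
    (h0 : (prodBernoulli (fun e' : Sym2 (Fin n) => if (∀ z ∈ e', z ∈ S) ∧ ¬ e'.IsDiag then 1 else Function.update u s(x, y) 0 e')).real
          ((⋃ v ∈ S, ⋃ a ∈ A, openConn v a) ∩ openConn d b)
        ≤ (prodBernoulli (fun e' : Sym2 (Fin n) => if (∀ z ∈ e', z ∈ S) ∧ ¬ e'.IsDiag then 1 else Function.update u s(x, y) 0 e')).real
          (⋃ v ∈ S, openConn v b))
    (hT : (prodBernoulli (fun e' : Sym2 (Fin n) => if (∀ z ∈ e', z ∈ insert y S) ∧ ¬ e'.IsDiag then 1 else Function.update u s(x, y) 0 e')).real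
          ((⋃ v ∈ insert y S, ⋃ a ∈ A, openConn v a) ∩ openConn d b)
        ≤ (prodBernoulli (fun e' : Sym2 (Fin n) => if (∀ z ∈ e', z ∈ insert y S) ∧ ¬ e'.IsDiag then 1 else Function.update u s(x, y) 0 e')).real
          (⋃ v ∈ insert y S, openConn v b)) :
    (prodBernoulli (fun e' : Sym2 (Fin n) => if (∀ z ∈ e', z ∈ S) ∧ ¬ e'.IsDiag then 1 else u e')).real
        ((⋃ v ∈ S, ⋃ a ∈ A, openConn v a) ∩ openConn d b)
      ≤ (prodBernoulli (fun e' : Sym2 (Fin n) => if (∀ z ∈ e', z ∈ S) ∧ ¬ e'.IsDiag then 1 else u e')).real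
        (⋃ v ∈ S, openConn v b) :=
  dKernel_interp u A S b d s(x, y) h0 (dKernel_sure_insert u A S b d x y hxS hyS hT)

/-- **Edge-deletion minimisers are `D`-good** (mod the inner induction hypothesis at `u[e↦0]`).  [cite: KozmaNitzan2024, §3.2 Lemma 5 p. 13, Thms 4–5 pp. 12–14] -/
theorem dKernel_of_edgeMin (u : Sym2 (Fin n) → unitInterval) (A S : Finset (Fin n)) (b d x y : Fin n)
    (hb : b ∈ A) (hSA : Disjoint S A) (hxS : x ∈ S) (hyS : y ∉ S)
    (hdmin : ∀ a ∈ A, (prodBernoulli (Function.update u s(x, y) 0)).real (openConn d b)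
      ≤ (prodBernoulli (Function.update u s(x, y) 0)).real (openConn a b))
    (hIH : ∀ S' : Finset (Fin n), Disjoint S' A →
      (prodBernoulli (fun e' : Sym2 (Fin n) => if (∀ z ∈ e', z ∈ S') ∧ ¬ e'.IsDiag then 1 else Function.update u s(x, y) 0 e')).real
          ((⋃ v ∈ S', ⋃ a ∈ A, openConn v a) ∩ openConn d b)
        ≤ (prodBernoulli (fun e' : Sym2 (Fin n) => if (∀ z ∈ e', z ∈ S') ∧ ¬ e'.IsDiag then 1 else Function.update u s(x, y) 0 e')).real
          (⋃ v ∈ S', openConn v b)) :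
    (prodBernoulli (fun e' : Sym2 (Fin n) => if (∀ z ∈ e', z ∈ S) ∧ ¬ e'.IsDiag then 1 else u e')).real
        ((⋃ v ∈ S, ⋃ a ∈ A, openConn v a) ∩ openConn d b)
      ≤ (prodBernoulli (fun e' : Sym2 (Fin n) => if (∀ z ∈ e', z ∈ S) ∧ ¬ e'.IsDiag then 1 else u e')).real
        (⋃ v ∈ S, openConn v b) := by
  refine dKernel_of_edgeLayers u A S b d x y hxS hyS (hIH S hSA) ?_
  have hbS : b ∉ S := fun h => Finset.disjoint_left.1 hSA h hb
  by_cases hyb : y = b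
  · -- the layer block contains the target: its reach is everything
    subst hyb
    refine le_trans (measureReal_mono (Set.subset_univ _) (measure_ne_top _ _)) (le_of_eq ?_)
    have huniv : (⋃ v ∈ insert y S, (openConn v y : Set (BondConfig (Fin n)))) = Set.univ :=
      Set.eq_univ_of_forall fun ω => Set.mem_iUnion₂.2 ⟨y, Finset.mem_insert_self y S,
        (SimpleGraph.Reachable.refl y : (openGraph ω).Reachable y y)⟩
    rw [huniv]
  by_cases hyA : y ∈ A
  · have hbT : b ∉ insert y S := by
      rw [Finset.mem_insert]
      rintro (h | h)
      · exact hyb h.symm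
      · exact hbS h
    exact dKernel_of_leaf (Function.update u s(x, y) 0) A (insert y S) b d y (Finset.mem_insert_self y S) hbT (hdmin y hyA)
  · exact hIH (insert y S) (Finset.disjoint_insert_left.2 ⟨hyA, hSA⟩)

end DKernelEdge

end

end Summit.CriticalPhenomena.PercolationContinuityZ3.Theorems
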